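import Summits.QuantumFields.YangMills.Theses.HyperbolicRegulator

/-!
# Line `giant_beta_gjs` for crux `CurvatureAnchorR` (stmt-QuantumFields-18155) — `Lines/giant_beta_gjs.lean`

RE-REGISTRATION under the REPAIRED crux (crux-strategist seat
`planner-cstrat-stmt-QuantumFields-18155-b1-0`, 2026-08-17) of the strategist line of the same name filed on the
refuted-MISSTATED predecessor `CurvatureAnchor` (stmt-QuantumFields-15826, `Cruxes/CurvatureAnchor/Lines/giant_beta_gjs.lean`,
by `planner-cstrat-stmt-QuantumFields-15826-b1-0`).  As promised there (§"Status of the crux AS TYPED"), in the route text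
(rev 5: "Registered lines (giant_beta_gjs, birth) re-register verbatim with the repaired Adm") and in `PICKED.md` of the old
crux, the file is VERBATIM up to: (i) the admissibility predicate is the repaired `AdmR` (flat threshold `k / 2 < dist`,
deep threshold `3 * (k / 4) < dist`, chart box `(k:ℤ)/4` unchanged — byte-identical to `(Fam k j …).1` of
`Summit.QuantumFields.YangMills.Theses.HyperbolicRegulator.CurvatureAnchorR` and to the disprover's
`Cruxes.CurvatureAnchor.Disproof.AdmR`); (ii) the copied `Fam` prefix of `stub_gjs` is the repaired one (byte-identical to
the route decl up to `let Sp := …;`); (iii) the composition is `CurvatureAnchorR_of : …HyperbolicRegulator.CurvatureAnchorR`;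
(iv) namespace `…Cruxes.CurvatureAnchorR.GiantBetaGJS`.  `Tame`, `Coh`, `DualPoinc`, `SqCx`, `Poinc`, `KunnethGap`,
`stub_kunneth` and the glue are untouched.  With the repair, `stub_towers` is no longer stub-false (the entry point of
`NoAdmissibleComplex.no_admissible` is closed for EVERY complex by `AdmR.chart_avoids_cones`, kernel-checked in the old
crux's `Disproof.lean` §2; refuter vetting of 18155: all `AdmR` clauses pass on the exact Bring `{4,5}_k` models,
`k = 8..24`).

## The lever (unchanged): `β₀(k)` is free, so NO renormalisation group is run

In the crux the threshold `β₀` is chosen AFTER `k` and the constants `C, j₀` after `(k, β, A, B)`; only the rate constant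
`c` is uniform.  Taking `β₀(k) ≥ exp k` absorbs every `poly(k)`/`exp(k)` loss of a one-shot treatment at scale `k`.  What
is left has the theorem-shape of Chatterjee–Yakir (arXiv:2509.19176, Thm 1 + Remark 2: exponential clustering of the
`U(1)` lattice Higgs/Proca model for EVERY mass `m > 0` once `β ≥ β₀(d, m)`, Glimm–Jaffe–Spencer cluster expansion around
the MASSIVE Gaussian), transplanted with `m ↦ 10⁻⁷/k²` (the Künneth–Poincaré gap, `stub_kunneth`), blocks of side `≍ k·L₀`,
block-axial gauge + compact collective coordinates for the torons, large fields declared on plaquettes.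

## The cut (3 stubs, as before)

* `stub_towers` — COMBINATORICS (G-free, L): a family that is admissible (`AdmR`), tame at a scale `L ≥ j` dominating the
  diameter (`diam ≤ C_T · L`: LOG-GIRTH towers — congruence covers of the arithmetic `(2,4,5)` triangle group,
  Katz–Schaps–Vishne systole `≥ (4/3) log g`, expander diameter `≤ C log g`), coherently oriented (`Coh`), with the dual
  Poincaré inequality (`DualPoinc`).
* `stub_kunneth` — SPECTRAL GRAPH THEORY (G-free, TRUE, M/L): `SqCx ∧ Poinc ∧ Coh ∧ DualPoinc ⇒ KunnethGap` (gap
  `≥ 10⁻⁷/k²` of the 1-form Hodge Laplacian of `S × S` off the harmonic forms; FALSE for `S × ℤ²`).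
* `stub_gjs` — THE ANALYSIS (XL, open, load-bearing): for every family as delivered by `stub_towers` and satisfying
  `KunnethGap`, the anchor conclusion — verbatim the crux's clustering functional `(Fam …).2` at rate `c/k`.
* `CurvatureAnchorR_of` — the composition BY NAME (type literally the route decl).

## Strategist's sharpening of the hardest sub-issue (new, 18155 seat): ℓ¹-MARGINALITY of the expansion-gapped Gaussian

Recorded here because it bears on HOW `stub_gjs` can be proved (full argument: `STRATEGY-CENSUS.md` of this crux, §Transfer).
The reference Gaussian's covariance `(Δ₁^{Künneth})⁺` has an L²-gap `10⁻⁷/k²` and POINTWISE decay at rate `≍ 1/k`, but its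
rows are NOT uniformly summable: on a hyperbolic factor the heat kernel at time `t ≫ k²` lives on a ring of radius `≍ t/k`
where it varies at unit relative rate radially, so `‖∇p_t‖_{ℓ¹} ≍ 1/k` for ALL `t` up to the mixing time `≍ k² log vol_j`,
whence `sup_x Σ_y |∇G^⊥(x,y)| ≍ k log vol_j` (Brooks: `λ₀ ≤ h²/4`, decay rate never beats volume entropy — generic for a
mass that comes from expansion rather than from a potential).  A Kotecký–Preiss / GJS convergence criterion is an
ℓ¹-type norm (activity per inter-block link `≍ g(β)² · |C(B,B′)|`, summed over partners), so at FIXED `β` the single-scale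
expansion converges only while `k log vol_j ≲ β^{1/2}/poly(k)`, i.e. for `j ≤ j_max(β)`, whereas the crux needs ALL
`j ≥ j₀` at fixed `β`.  Consequences for a prover of `stub_gjs`: either (α) the expansion must be MULTI-SCALE IN THE
INFRARED (scales `k, 2k, 4k, … , diam_j`; at each scale the slice covariance has `O(1)`·`k` ℓ¹-norm concentrated on one
ring, and the coupling does not grow because the curvature has already frozen it — an RG with trivial flow but non-trivial
bookkeeping), or (β) the marginal modes must be recognised as PURE GAUGE (the ℓ^∞-bottom of `Δ₁` on the simply connected
cover consists of closed 1-forms) and the expansion organised in curvature variables, or (γ) one abandons summability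
altogether for an L²-only method — the sibling line `Lines/witten_hessian.lean` (Helffer–Sjöstrand + Combes–Thomas with the
symmetric/antisymmetric split, rate `√gap ≍ 1/k` from the form bound alone).  This does NOT make `stub_gjs` false; it
retires the slogan "β₀(k) free ⇒ single-scale problem" as a proof plan for `j → ∞` and names the first place where the
Chatterjee–Yakir transfer breaks BEFORE the torons: amenability of `ℤ^d`.

## Disproof used

No `Disproof.lean` exists yet for stmt-QuantumFields-18155.  From the predecessor's `Cruxes/CurvatureAnchor/Disproof.lean`
(refuter-cdisprove-15826, cycle 1): §2 `AdmR` (copied byte-exactly below), `repair_arith`, `AdmR.chart_dist_le`,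
`AdmR.chart_avoids_cones` (why `stub_towers` is no longer stub-false); §3(f) `stub_kunneth` TRUE as typed (hand-checked
there independently); §4 names the toron floor at fixed `(k, β)` as the disprover's next target — `stub_towers`'s
`diam ≤ C_T·L` (log-girth) is this line's typed answer.  No `_false_without_` theorem exists; `ledger negatives --problem
QuantumFields` has no entry on square complexes / expanders, so no stub instantiates a refuted statement; the dropped
pre-repair `Adm` (refuted via `no_admissible`) appears nowhere in this file.

`lean check`: rc 0; sorries = 3 = stubs (`stub_towers`, `stub_kunneth`, `stub_gjs`), zero elsewhere.
Namespace `Summit.QuantumFields.YangMills.Cruxes.CurvatureAnchorR.GiantBetaGJS`.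
-/

set_option autoImplicit false

noncomputable section

namespace Summit.QuantumFields.YangMills.Cruxes.CurvatureAnchorR.GiantBetaGJS

open scoped BigOperators Topology Manifold Classical MeasureTheory ProbabilityTheory Matrix InnerProductSpace ComplexConjugate ContinuousMap
open Filter Set Function TopologicalSpace MeasureTheory
open Literature.MathematicalPhysics.QuantumFieldTheory Literature.MathematicalPhysics.QuantumLattice
open Summit.QuantumFields.YangMills.Theses.HyperbolicRegulator

/-- ADMISSIBILITY of one finite square complex at curvature scale `k` and separation index `j` —
VERBATIM the first component `(Fam k j V E Q σ τ bd cV cE).1` of the REPAIRED crux `CurvatureAnchorR`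
(flat `k / 2 < dist`, deep `3 * (k / 4) < dist`, chart box `(k:ℤ)/4`; byte-identical to the disprover's
`Cruxes.CurvatureAnchor.Disproof.AdmR`; `G`-free). -/
def AdmR (k j : ℕ) (V E Q : Finset ℕ) (σ τ : ℕ → ℕ) (bd : ℕ → Fin 4 → ℕ × Bool) (cV : ℕ → ℤ × ℤ → ℕ)
    (cE : ℕ → ℤ × ℤ → Fin 2 → ℕ × Bool) : Prop :=
  let st := fun e : ℕ × Bool => if e.2 then σ e.1 else τ e.1; let en := fun e : ℕ × Bool => if e.2 then τ e.1 else σ e.1; let Γ := SimpleGraph.fromRel fun a b : ℕ => ∃ e ∈ E, σ e = a ∧ τ e = b; let dg := fun x : ℕ => (E.filter fun e => σ e = x ∨ τ e = x).card; let K := V.filter fun x => dg x = 5; let F := fun x : ℕ => x ∈ V ∧ ∀ c ∈ K, k / 2 < Γ.dist x c; let Dp := fun x : ℕ => x ∈ V ∧ ∀ c ∈ K, 3 * (k / 4) < Γ.dist x c; let ib := fun a : ℤ × ℤ => |a.1| ≤ (k : ℤ) / 4 ∧ |a.2| ≤ (k : ℤ) / 4; let nx := fun (a : ℤ × ℤ)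 (μ : Fin 2) => if μ = 0 then (a.1 + 1, a.2) else (a.1, a.2 + 1); (∀ e ∈ E, σ e ∈ V ∧ τ e ∈ V ∧ σ e ≠ τ e) ∧ (∀ q ∈ Q, (∀ i, (bd q i).1 ∈ E) ∧ (∀ i, en (bd q i) = st (bd q (i + 1))) ∧ (st ∘ bd q).Injective) ∧ (∀ e ∈ E, (Q.filter fun q => ∃ i, (bd q i).1 = e).card = 2) ∧ (∀ x ∈ V, (dg x = 4 ∨ dg x = 5) ∧ (Q.filter fun q => ∃ i, st (bd q i) = x).card = dg x) ∧ (∀ x ∈ V, ∃ c ∈ K, Γ.dist x c ≤ k) ∧ (∀ c ∈ K, ∀ c' ∈ K, c ≠ c' → k ≤ Γ.dist c c') ∧ (∀ f : ℕ → ℝ, ∑ x ∈ V, f x = 0 → ∑ x ∈ V, f x ^ 2 ≤ 10 ^ 6 * (k : ℝ) ^ 2 * ∑ e ∈ E, (f (σ e) - f (τ e)) ^ 2) ∧ (∃ x y, Dp x ∧ Dp y ∧ j ≤ Γ.dist x y) ∧ (∀ x, F x → cV x (0, 0) = x ∧ (∀ a, ib a → cV x a ∈ V) ∧ Set.InjOn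 (cV x) {a | ib a} ∧ (∀ a μ, ib a → ib (nx a μ) → (cE x a μ).1 ∈ E ∧ st (cE x a μ) = cV x a ∧ en (cE x a μ) = cV x (nx a μ)) ∧ (∀ a, ib a → ib (a.1 + 1, a.2 + 1) → ∃ q ∈ Q, Finset.univ.image (Prod.fst ∘ bd q) = {(cE x a 0).1, (cE x (nx a 0) 1).1, (cE x (nx a 1) 0).1, (cE x a 1).1}))

/-- TAMENESS at scale `L` (the topology handed across the seam; `G`-free). (i) NO PINCHES: two
distinct squares share at most one edge, so every vertex link is a cycle (`C₄` or `C₅`) and the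
complex is a closed non-positively curved square surface; (ii) BALLS OF RADIUS `L` ARE `ℤ/2`-ACYCLIC IN
DEGREE ONE: for every vertex `x`, on the full subcomplex spanned by the vertices within graph distance
`L` of `x` (its edges `EB`, its squares `QB`), every `ℤ/2` 1-cocycle `Z ⊆ EB` (each square of `QB`
contains an even number of `Z`-edges) is a coboundary (`Z = δW`: the edges with exactly one endpoint
in `W`). For a surface complex a proper connected subcomplex has free `π₁`, so (ii) says every
`L`-ball is simply connected: combinatorial injectivity radius `≳ L`, no essential loop shorter than
`≈ 2L` — separating or not. -/
def Tame (L : ℕ) (V E Q : Finset ℕ) (σ τ : ℕ → ℕ) (bd : ℕ → Fin 4 → ℕ × Bool) : Prop :=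
  let st := fun e : ℕ × Bool => if e.2 then σ e.1 else τ e.1
  let Γ := SimpleGraph.fromRel fun a b : ℕ => ∃ e ∈ E, σ e = a ∧ τ e = b
  (∀ q ∈ Q, ∀ q' ∈ Q, q ≠ q' →
      (Finset.univ.image (Prod.fst ∘ bd q) ∩ Finset.univ.image (Prod.fst ∘ bd q')).card ≤ 1) ∧
  ∀ x ∈ V,
    let B := V.filter fun y => ∃ p : Γ.Walk x y, p.length ≤ L
    let EB := E.filter fun e => σ e ∈ B ∧ τ e ∈ B
    let QB := Q.filter fun q => ∀ i, st (bd q i) ∈ B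
    ∀ Z ⊆ EB, (∀ q ∈ QB, Even ((Finset.univ.filter fun i : Fin 4 => (bd q i).1 ∈ Z).card)) →
      ∃ W ⊆ B, ∀ e ∈ EB, (e ∈ Z ↔ Xor (σ e ∈ W) (τ e ∈ W))


/-- COHERENT ORIENTATION of the squares (`G`-free): whenever two distinct squares contain the same
edge they traverse it with opposite direction flags — an orientation of the closed square surface
(the intended covers of Bring's / the `(2,4,5)` surface are orientable).  With `AdmR` (every edge in
exactly two squares) this makes `ker d₁* =` constants, so the dual Poincaré inequality below is the
honest dual-graph spectral gap. -/
def Coh (Q : Finset ℕ) (bd : ℕ → Fin 4 → ℕ × Bool) : Prop :=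
  ∀ q ∈ Q, ∀ q' ∈ Q, q ≠ q' → ∀ i i' : Fin 4, (bd q i).1 = (bd q' i').1 → (bd q i).2 ≠ (bd q' i').2

/-- DUAL POINCARÉ INEQUALITY at scale `k` (`G`-free): for every real function `g` on the squares
with `∑_Q g = 0`, `∑_Q g² ≤ 10⁶ k² · ∑_{e ∈ E} (∑_{q ∋ e} ± g q)²`, the sign being the direction
flag with which `q` traverses `e` (so with `Coh` the inner sum is `±(g q₁ − g q₂)` over the two
squares at `e`: the Dirichlet form of the DUAL graph).  Same constant as the primal clause 7 of
`AdmR`; for the intended family the dual graph is again a `k`-subdivided-type hyperbolic surface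
graph with gap `≍ 1/k²`. -/
def DualPoinc (k : ℕ) (E Q : Finset ℕ) (bd : ℕ → Fin 4 → ℕ × Bool) : Prop :=
  ∀ g : ℕ → ℝ, ∑ q ∈ Q, g q = 0 →
    ∑ q ∈ Q, g q ^ 2 ≤ 10 ^ 6 * (k : ℝ) ^ 2 *
      ∑ e ∈ E, (∑ q ∈ Q, ∑ i : Fin 4, if (bd q i).1 = e then (if (bd q i).2 then g q else -g q) else 0) ^ 2

/-- SQUARE-COMPLEX WELL-FORMEDNESS (`G`-free) — VERBATIM clauses 1–3 of `AdmR` with its `st/en`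
vocabulary: edges have distinct endpoints in `V`; every square boundary is a closed 4-edge word in
`E` through 4 distinct vertices; every edge lies in exactly two squares.  (All that `stub_kunneth`
needs of admissibility besides the Poincaré clause; unaffected by the R3 repair.) -/
def SqCx (V E Q : Finset ℕ) (σ τ : ℕ → ℕ) (bd : ℕ → Fin 4 → ℕ × Bool) : Prop :=
  let st := fun e : ℕ × Bool => if e.2 then σ e.1 else τ e.1
  let en := fun e : ℕ × Bool => if e.2 then τ e.1 else σ e.1
  (∀ e ∈ E, σ e ∈ V ∧ τ e ∈ V ∧ σ e ≠ τ e) ∧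
    (∀ q ∈ Q, (∀ i, (bd q i).1 ∈ E) ∧ (∀ i, en (bd q i) = st (bd q (i + 1))) ∧ (st ∘ bd q).Injective) ∧
      (∀ e ∈ E, (Q.filter fun q => ∃ i, (bd q i).1 = e).card = 2)

/-- PRIMAL POINCARÉ INEQUALITY at scale `k` (`G`-free) — VERBATIM clause 7 of `AdmR`:
`∑_V f² ≤ 10⁶ k² ∑_E (f(σe) − f(τe))²` for every `f` with `∑_V f = 0` (graph spectral gap
`≥ 10⁻⁶/k²`; it also forces connectedness). -/
def Poinc (k : ℕ) (V E : Finset ℕ) (σ τ : ℕ → ℕ) : Prop :=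
  ∀ f : ℕ → ℝ, ∑ x ∈ V, f x = 0 → ∑ x ∈ V, f x ^ 2 ≤ 10 ^ 6 * (k : ℝ) ^ 2 * ∑ e ∈ E, (f (σ e) - f (τ e)) ^ 2

/-- **The Künneth–Poincaré gap of the product complex** (conclusion of `stub_kunneth`, hypothesis
of `stub_gjs`; `G`-free).  Real 1-cochains `ω` on the product edge set
`PE = (E × V) ⊔ (V × E)` of `X = S × S` (values off `PE` are never read), the product coboundary
`d₁` on the three plaquette sorts — square×vertex `(q, y)`, vertex×square `(y, q)` and edge×edge
`(e, e')`, the last with EXACTLY the boundary word of the action's edge×edge plaquette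
`[(inl (e, σ e'), +), (inr (τ e, e'), +), (inl (e, τ e'), −), (inr (σ e, e'), −)]` — and the
divergence `d₀*` at product vertices `(x, y) ∈ V × V` (plain `ℓ²` adjoint of the product gradient).
`Harm h`: `d₁ h = 0` on all three sorts and `d₀* h = 0`.  The statement: every `ω` is within
`10⁷ k² · (‖d₀* ω‖² + ‖d₁ ω‖²)` (in `ℓ²(PE)`) of a harmonic `h` — i.e. the Hodge Laplacian
`Δ₁ = d₀d₀* + d₁*d₁` of `X` has spectral gap `≥ 10⁻⁷/k²` on the orthocomplement of the harmonic
(toron) 1-cochains.  Mechanism (Künneth): `C¹(X) = C¹(S)⊗C⁰(S) ⊕ C⁰(S)⊗C¹(S)` with the Koszul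
sign, `Δ₁^X = Δ^S ⊗ 1 + 1 ⊗ Δ^S`, so the non-zero spectrum is bounded below by
`min(λ₁(Δ₀^S), λ₁(Δ₂^S)) ≥ 10⁻⁶/k²` (primal Poincaré = clause 7 of `AdmR`, dual Poincaré =
`DualPoinc` with coherent orientations `Coh`): a factorwise-harmonic form tensored with a
NON-constant function still pays the other factor's Poincaré constant — the reason the product of
TWO hyperbolic factors is forced (S × ℤ² is gapless).  The cochain formulas below were checked
against this Kronecker-sum identity by exact integer arithmetic on torus grids
(`compute/kunneth_check.py`, n = 3, 4: `d₁∘d₀ = 0`, `div = d₀ᵀ`, `Δ₁^X = Künneth sum` all `True`). -/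
def KunnethGap (k : ℕ) (V E Q : Finset ℕ) (σ τ : ℕ → ℕ) (bd : ℕ → Fin 4 → ℕ × Bool) : Prop :=
  let sg := fun b : ℕ × Bool => (if b.2 then (1 : ℝ) else -1)
  let dA := fun (ω : ((ℕ × ℕ) ⊕ (ℕ × ℕ) → ℝ)) (q y : ℕ) => ∑ i : Fin 4, sg (bd q i) * ω (Sum.inl ((bd q i).1, y))
  let dB := fun (ω : ((ℕ × ℕ) ⊕ (ℕ × ℕ) → ℝ)) (y q : ℕ) => ∑ i : Fin 4, sg (bd q i) * ω (Sum.inr (y, (bd q i).1))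
  let dC := fun (ω : ((ℕ × ℕ) ⊕ (ℕ × ℕ) → ℝ)) (e e' : ℕ) =>
    ω (Sum.inl (e, σ e')) + ω (Sum.inr (τ e, e')) - ω (Sum.inl (e, τ e')) - ω (Sum.inr (σ e, e'))
  let dv := fun (ω : ((ℕ × ℕ) ⊕ (ℕ × ℕ) → ℝ)) (x y : ℕ) =>
    (∑ e ∈ E.filter (fun e => τ e = x), ω (Sum.inl (e, y))) - (∑ e ∈ E.filter (fun e => σ e = x), ω (Sum.inl (e, y))) +
      ((∑ e ∈ E.filter (fun e => τ e = y), ω (Sum.inr (x, e))) - ∑ e ∈ E.filter (fun e => σ e = y), ω (Sum.inr (x, e)))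
  let Harm := fun (h : ((ℕ × ℕ) ⊕ (ℕ × ℕ) → ℝ)) =>
    (∀ q ∈ Q, ∀ y ∈ V, dA h q y = 0) ∧ (∀ y ∈ V, ∀ q ∈ Q, dB h y q = 0) ∧
      (∀ e ∈ E, ∀ e' ∈ E, dC h e e' = 0) ∧ (∀ x ∈ V, ∀ y ∈ V, dv h x y = 0)
  let Nm := fun (ω : ((ℕ × ℕ) ⊕ (ℕ × ℕ) → ℝ)) => (∑ e ∈ E, ∑ y ∈ V, ω (Sum.inl (e, y)) ^ 2) + ∑ y ∈ V, ∑ e ∈ E, ω (Sum.inr (y, e)) ^ 2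
  let Dir := fun (ω : ((ℕ × ℕ) ⊕ (ℕ × ℕ) → ℝ)) =>
    (∑ x ∈ V, ∑ y ∈ V, dv ω x y ^ 2) + (∑ q ∈ Q, ∑ y ∈ V, dA ω q y ^ 2) +
      (∑ y ∈ V, ∑ q ∈ Q, dB ω y q ^ 2) + ∑ e ∈ E, ∑ e' ∈ E, dC ω e e' ^ 2
  ∀ ω : (ℕ × ℕ) ⊕ (ℕ × ℕ) → ℝ, ∃ h : (ℕ × ℕ) ⊕ (ℕ × ℕ) → ℝ,
    Harm h ∧ Nm (fun z => ω z - h z) ≤ 10 ^ 7 * (k : ℝ) ^ 2 * Dir ω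

/-- **Stub T — LOG-GIRTH EXPANDER SQUARE TOWERS (combinatorics / spectral geometry; `G`-free;
L-sized modulo cited inputs; with the repaired `AdmR` no longer stub-false — `AdmR.chart_avoids_cones`).**  There are `C_T` and a family `S_(k,j)` such that for every
`k ≥ 8` and every `j`: `AdmR k j` (the crux's admissibility, verbatim); tameness at a scale `L ≥ j`
(`Tame L`: no pinches, every `L`-ball `ℤ/2`-acyclic in degree one = simply connected) which
DOMINATES THE DIAMETER, `dist x y ≤ C_T · L` for all vertices; coherent square orientations; the
dual Poincaré inequality at scale `k`.  Intended witness: `k`-subdivisions of the `{4,5}` square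
tilings of the closed surfaces `ℍ²/Γ` for torsion-free CONGRUENCE subgroups `Γ` of the arithmetic
triangle group `Δ⁺(2,4,5)` (it preserves the `{4,5}` tiling; Takeuchi's list), indexed so that the
`j`-th member has combinatorial injectivity radius in `(j, j + O(k)]`: uniform spectral gap along
the tower (Selberg/Jacquet–Langlands/Kim–Sarnak `λ₁ ≥ 975/4096` for congruence quotients,
discretised: graph and dual-graph Poincaré constants `≍ 25k² ≤ 10⁶k²`), systole
`≥ (4/3) log(genus) − O(1)` (Katz–Schaps–Vishne 2007) against diameter `≤ C log(genus)` (expander),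
both scaling by `k` under subdivision, whence `C_T`; orientability gives `Coh`; `AdmR` (repaired) by
the developing map (cones = big vertices, pairwise `= k` apart, density `≤ k` with equality at
big-square centres, flat `ℤ²`-charts of sup-radius `⌊k/4⌋` at every point farther than `⌊k/2⌋`
from the cones; refuter vetting of 18155: every `AdmR` clause passes on the exact Bring `{4,5}_k` models, `k = 8..24`).
Why it might fail: only bookkeeping — the discretisation constants
(Brooks/Mantuano) must land below `10⁶`, and the index shift `L ≤ j + O(k)` needs bounded
log-jumps between consecutive congruence levels. -/
theorem stub_towers :
    ∃ (CT : ℕ) (V E Q : ℕ → ℕ → Finset ℕ) (σ τ : ℕ → ℕ → ℕ → ℕ) (bd : ℕ → ℕ → ℕ → Fin 4 → ℕ × Bool) (cV : ℕ → ℕ → ℕ → ℤ × ℤ → ℕ) (cE : ℕ → ℕ → ℕ → ℤ × ℤ → Fin 2 → ℕ × Bool), ∀ k j : ℕ, 8 ≤ k → AdmR k j (V k j) (E k j) (Q k j) (σ k j) (τ k j) (bd k j) (cV k j) (cE k j) ∧ (∃ L : ℕ, j ≤ L ∧ Tame L (V k j) (E k j) (Q k j) (σ k j) (τ k j) (bd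 k j) ∧ ∀ x ∈ V k j, ∀ y ∈ V k j, (SimpleGraph.fromRel fun a b : ℕ => ∃ e ∈ E k j, σ k j e = a ∧ τ k j e = b).dist x y ≤ CT * L) ∧ Coh (Q k j) (bd k j) ∧ DualPoinc k (E k j) (Q k j) (bd k j) := by
  sorry

/-- **Stub K — THE KÜNNETH–POINCARÉ GAP (finite-dimensional Hodge theory; `G`-free; TRUE; M/L).**
For every well-formed square complex (`SqCx`, clauses 1–3 of `AdmR`) with the primal Poincaré
inequality (`Poinc`, clause 7), coherent orientations and the dual Poincaré inequality, the
product complex `S × S` satisfies `KunnethGap k`: its 1-form Hodge Laplacian has spectral gap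
`≥ 10⁻⁷/k²` off the harmonic 1-cochains.  Proof sketch: `Poinc` is `λ₁(Δ₀^S) ≥ 10⁻⁶/k²`
(and connectedness); `Coh` + clause 3 + `DualPoinc` give `λ₁(Δ₂^S) ≥ 10⁻⁶/k²` with
`Δ₂ = d₁d₁*`; 2-d Hodge theory: the non-zero spectrum of `Δ₁^S` is that of `Δ₀^S ∪ Δ₂^S`;
Künneth: `C¹(X) = C¹⊗C⁰ ⊕ C⁰⊗C¹`, `Δ₁^X = Δ^S⊗1 + 1⊗Δ^S` (the cochain formulas of `KunnethGap`
realise exactly this tensor product with the Koszul sign — checked by exact arithmetic,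
`compute/kunneth_check.py`), so every non-zero eigenvalue of `Δ₁^X` is `≥ 10⁻⁶/k²`, and
`h := P_harm ω` gives `‖ω − h‖² ≤ 10⁶k² ⟨ω, Δ₁ω⟩ = 10⁶k² (‖d₀*ω‖² + ‖d₁ω‖²)`.  Leans on: Mathlib
finite-dimensional spectral theorem (`LinearMap.IsSymmetric`), `Finset.sum` algebra. -/
theorem stub_kunneth :
    ∀ (k : ℕ) (V E Q : Finset ℕ) (σ τ : ℕ → ℕ) (bd : ℕ → Fin 4 → ℕ × Bool), SqCx V E Q σ τ bd → Poinc k V E σ τ → Coh Q bd → DualPoinc k E Q bd → KunnethGap k V E Q σ τ bd := by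
  sorry

/-- **Stub A — SINGLE-SCALE GLIMM–JAFFE–SPENCER EXPANSION AT GIANT `β` (the analysis; XL, open,
load-bearing).**  For every compact simple `G`, faithful unitary `r`, every `C_T` and EVERY family
that is admissible for all `k ≥ 8`, all `j`, tame at a diameter-dominating scale `L ≥ j`, and
satisfies `KunnethGap k` at every `(k, j)`: ONE `c > 0` (intended `c = min(1, 2/C_T)/C₀`) such
that for every `k ≥ 8` there is `β₀(k)` (intended `exp k`) with the crux's clustering conclusion —
VERBATIM the functional `(Fam …).2` of the crux (product Haar on the product edge set, weight
`exp(β S)` over the three square sorts, chart-read `YMSpecies` of support `≤ k/8` at flat base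
points, rate `c/k` in `dist + dist'`, constants `C, j₀` depending on `(k, β, A, B)`).  Mechanism:
Chatterjee–Yakir arXiv:2509.19176 (GJS around a massive Gaussian; blocks `L₀ ≫ 1/m`; Gevrey
partition of unity in the field size; bad blocks do not percolate) with `m ↦` the Künneth gap,
blocks of side `L₀ k`, block-axial gauge on the simply connected `L`-balls (`Tame`), the Gaussian
covariance `(Δ₁ + gauge term)⁻¹ ⊥ torons` decaying at rate `≍ 1/k` inside `L`-balls
(Carne–Varopoulos on the `{4,5}_k` development, Cheeger `≍ 1/k`; the gap alone would give only
`1/k²`), torons (`4g_j` harmonic modes, compact in the true theory) integrated as collective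
coordinates and reaching `k/8`-local gauge-invariant observables only through loops of length
`≥ 2L`, each such term `≤ e^{−2L/k} ≤ e^{−(2/(C_T k))·diam}`; all `poly(k)`/`exp(k)` losses go into
`β₀(k)`.  Why it might fail: (a) non-abelian block-axial gauge: the Gaussian is only transversally
non-degenerate and the Haar/Faddeev–Popov Jacobian on trees of depth `≍ k` must stay in the
small-field regime (fine at `β ≥ exp k`, unprinted); (b) the light fibred sector
`(harmonic on S) ⊗ (functions on S)` has mass only from `λ₁(Δ₀^S)` and its Gaussian covariance
carries a `1/vol`-type floor whose block-sums grow like `log vol` — it must be carried by the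
compact toron coordinates, not by the Gaussian (the genuinely new step; no print for non-abelian
`G`); (c) large fields are declared on plaquettes, not edges (no per-edge mass term as in CY25), so
the bad-block weights come from positivity of the Wilson action plus block-axial reconstruction,
with `exp(−c√β)`-type costs per plaquette — ample at `β ≥ exp k`, but the combinatorics of bad
regions straddling cone lines is unprinted. -/
theorem stub_gjs :
    open Literature.MathematicalPhysics.QuantumFieldTheory Literature.MathematicalPhysics.QuantumLattice MeasureTheory in ∀ (G : Type) [Group G] [TopologicalSpace G] [IsTopologicalGroup G] [CompactSpace G], IsCompactSimpleLieGroup G → letI : MeasurableSpace G := borel G; haveI : BorelSpace G := ⟨rfl⟩; ∀ r : LatticeRep G, let Fam := fun (k j : ℕ) (V E Q : Finset ℕ) (σ τ : ℕ → ℕ) (bd : ℕ → Fin 4 → ℕ × Bool) (cV : ℕ → ℤ × ℤ → ℕ) (cE : ℕ → ℤ × ℤ → Fin 2 → ℕ × Bool) => let st := fun e : ℕ × Bool => if e.2 then σ e.1 else τ e.1; let en := fun e : ℕ × Bool => if e.2 then τ e.1 else σ e.1; let Γ := SimpleGraph.fromRel fun a b : ℕ => ∃ e ∈ E, σ e = a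 ∧ τ e = b; let dg := fun x : ℕ => (E.filter fun e => σ e = x ∨ τ e = x).card; let K := V.filter fun x => dg x = 5; let F := fun x : ℕ => x ∈ V ∧ ∀ c ∈ K, k / 2 < Γ.dist x c; let Dp := fun x : ℕ => x ∈ V ∧ ∀ c ∈ K, 3 * (k / 4) < Γ.dist x c; let ib := fun a : ℤ × ℤ => |a.1| ≤ (k : ℤ) / 4 ∧ |a.2| ≤ (k : ℤ) / 4; let nx := fun (a : ℤ × ℤ) (μ : Fin 2) => if μ = 0 then (a.1 + 1, a.2) else (a.1, a.2 + 1); let Ed := (ℕ × ℕ) ⊕ (ℕ × ℕ); let PE : Finset Ed := (E ×ˢ V).disjSum (V ×ˢ E); let Cfg := ↥PE → G; let ν := Measure.pi fun _ : ↥PE => haarProbability G; let v := fun (U : Cfg) (e : Ed × Bool) => if h : e.1 ∈ PE then (if e.2 then U ⟨e.1, h⟩ else (U ⟨e.1, h⟩)⁻¹) else 1; let w := fun (U : Cfg) (e : Fin 4 → Ed × Bool) => (r.ρ (v U (e 0) * v U (e 1) * v U (e 2) * v U (e 3))).trace.re; let S := fun U : Cfg => (∑ q ∈ Q, ∑ y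 ∈ V, w U fun i => (Sum.inl ((bd q i).1, y), (bd q i).2)) + (∑ y ∈ V, ∑ q ∈ Q, w U fun i => (Sum.inr (y, (bd q i).1), (bd q i).2)) + ∑ e ∈ E, ∑ e' ∈ E, w U ![(Sum.inl (e, σ e'), true), (Sum.inr (τ e, e'), true), (Sum.inl (e, τ e'), false), (Sum.inr (σ e, e'), false)]; let d0 : Fin 4 → Fin 2 := ![0, 1, 0, 1]; let P := fun (x x' : ℕ) (U : Cfg) (p : ZdEdge 4) => let a := (p.1 0, p.1 1); let b := (p.1 2, p.1 3); if p.2 = 0 ∨ p.2 = 1 then v U (Sum.inl ((cE x a (d0 p.2)).1, cV x' b), (cE x a (d0 p.2)).2) else v U (Sum.inr (cV x a, (cE x' b (d0 p.2)).1), (cE x' b (d0 p.2)).2); ((∀ e ∈ E, σ e ∈ V ∧ τ e ∈ V ∧ σ e ≠ τ e) ∧ (∀ q ∈ Q, (∀ i, (bd q i).1 ∈ E) ∧ (∀ i, en (bd q i) = st (bd q (i + 1))) ∧ (st ∘ bd q).Injective) ∧ (∀ e ∈ E, (Q.filter fun q => ∃ i, (bd q i).1 = e).card = 2) ∧ (∀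 x ∈ V, (dg x = 4 ∨ dg x = 5) ∧ (Q.filter fun q => ∃ i, st (bd q i) = x).card = dg x) ∧ (∀ x ∈ V, ∃ c ∈ K, Γ.dist x c ≤ k) ∧ (∀ c ∈ K, ∀ c' ∈ K, c ≠ c' → k ≤ Γ.dist c c') ∧ (∀ f : ℕ → ℝ, ∑ x ∈ V, f x = 0 → ∑ x ∈ V, f x ^ 2 ≤ 10 ^ 6 * (k : ℝ) ^ 2 * ∑ e ∈ E, (f (σ e) - f (τ e)) ^ 2) ∧ (∃ x y, Dp x ∧ Dp y ∧ j ≤ Γ.dist x y) ∧ (∀ x, F x → cV x (0, 0) = x ∧ (∀ a, ib a → cV x a ∈ V) ∧ Set.InjOn (cV x) {a | ib a} ∧ (∀ a μ, ib a → ib (nx a μ) → (cE x a μ).1 ∈ E ∧ st (cE x a μ) = cV x a ∧ en (cE x a μ) = cV x (nx a μ)) ∧ (∀ a, ib a → ib (a.1 + 1, a.2 + 1) → ∃ q ∈ Q, Finset.univ.image (Prod.fst ∘ bd q) = {(cE x a 0).1, (cE x (nx a 0) 1).1, (cE x (nx a 1) 0).1, (cE x a 1).1})), fun (β m C : ℝ)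 (A B : YMSpecies G) => let X := fun f : Cfg → ℝ => (∫ U, f U * Real.exp (β * S U) ∂ν) / (∫ U, Real.exp (β * S U) ∂ν); ∀ x x' y y', F x → F x' → F y → F y' → |X (fun U => A.F (P x x' U) * B.F (P y y' U)) - X (fun U => A.F (P x x' U)) * X (fun U => B.F (P y y' U))| ≤ C * Real.exp (-(m * ((Γ.dist x y + Γ.dist x' y' : ℕ) : ℝ)))); let Sp := fun (A : YMSpecies G) (R : ℕ) => ∀ p ∈ A.supp, ∀ i, |p.1 i| ≤ (R : ℤ); ∀ (CT : ℕ) (V E Q : ℕ → ℕ → Finset ℕ) (σ τ : ℕ → ℕ → ℕ → ℕ) (bd : ℕ → ℕ → ℕ → Fin 4 → ℕ × Bool) (cV : ℕ → ℕ → ℕ → ℤ × ℤ → ℕ) (cE : ℕ → ℕ → ℕ → ℤ × ℤ → Fin 2 → ℕ × Bool), let Φ := fun k j => Fam k j (V k j) (E k j) (Q k j) (σ k j) (τ k j) (bd k j) (cV k j) (cE k j); (∀ k j, 8 ≤ k → (Φ k j).1) → (∀ k j, 8 ≤ k → ∃ L : ℕ, j ≤ L ∧ Tame L (V k j) (E k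 j) (Q k j) (σ k j) (τ k j) (bd k j) ∧ ∀ x ∈ V k j, ∀ y ∈ V k j, (SimpleGraph.fromRel fun a b : ℕ => ∃ e ∈ E k j, σ k j e = a ∧ τ k j e = b).dist x y ≤ CT * L) → (∀ k j, 8 ≤ k → KunnethGap k (V k j) (E k j) (Q k j) (σ k j) (τ k j) (bd k j)) → ∃ c : ℝ, 0 < c ∧ ∀ k, 8 ≤ k → ∃ β₀ : ℝ, ∀ β, β₀ ≤ β → ∀ A B : YMSpecies G, Sp A (k / 8) → Sp B (k / 8) → ∃ C j₀, ∀ j, j₀ ≤ j → (Φ k j).2 β (c / k) C A B := by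
  sorry

/-- **Composition (registered form)** — the three stubs BY NAME give the crux BY NAME (the type is
literally the route decl): take `C_T` and the family from `stub_towers`; its admissibility is
literally the crux's first conjunct (`AdmR k j … ≡ (Fam k j …).1` by `rfl`); `stub_kunneth` turns
clauses 1–3 and 7 of admissibility + coherence + dual Poincaré into `KunnethGap` at every `(k, j)`; `stub_gjs` applied to
the same family, its admissibility, its diameter-dominating tameness and the Künneth gaps is
literally the second conjunct. -/
theorem CurvatureAnchorR_of :
    Summit.QuantumFields.YangMills.Theses.HyperbolicRegulator.CurvatureAnchorR := by
  intro G _ _ _ _ hG r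
  obtain ⟨CT, V, E, Q, σ, τ, bd, cV, cE, h⟩ := stub_towers
  refine ⟨V, E, Q, σ, τ, bd, cV, cE, fun k j hk => (h k j hk).1, ?_⟩
  exact stub_gjs G hG r CT V E Q σ τ bd cV cE (fun k j hk => (h k j hk).1)
    (fun k j hk => (h k j hk).2.1)
    (fun k j hk => by
      obtain ⟨⟨h1, h2, h3, -, -, -, h7, -⟩, -, hC, hD⟩ := h k j hk
      exact stub_kunneth k (V k j) (E k j) (Q k j) (σ k j) (τ k j) (bd k j) ⟨h1, h2, h3⟩ h7 hC hD)

/-- **The glue alone, `sorry`-free** (hypothesis form `«towers» → «kunneth» → «gjs» →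
CurvatureAnchorR`; this `example` does not mention the stubs, so any `sorry` here would be flagged —
there is none). -/
example
    (hT : ∃ (CT : ℕ) (V E Q : ℕ → ℕ → Finset ℕ) (σ τ : ℕ → ℕ → ℕ → ℕ) (bd : ℕ → ℕ → ℕ → Fin 4 → ℕ × Bool) (cV : ℕ → ℕ → ℕ → ℤ × ℤ → ℕ) (cE : ℕ → ℕ → ℕ → ℤ × ℤ → Fin 2 → ℕ × Bool), ∀ k j : ℕ, 8 ≤ k → AdmR k j (V k j) (E k j) (Q k j) (σ k j) (τ k j) (bd k j) (cV k j) (cE k j) ∧ (∃ L : ℕ, j ≤ L ∧ Tame L (V k j) (E k j) (Q k j) (σ k j) (τ k j) (bd k j) ∧ ∀ x ∈ V k j, ∀ y ∈ V k j, (SimpleGraph.fromRel fun a b : ℕ => ∃ e ∈ E k j, σ k j e = a ∧ τ k j e = b).dist x y ≤ CT * L) ∧ Coh (Q k j) (bd k j) ∧ DualPoinc k (E k j) (Q k j) (bd k j))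
    (hK : ∀ (k : ℕ) (V E Q : Finset ℕ) (σ τ : ℕ → ℕ) (bd : ℕ → Fin 4 → ℕ × Bool), SqCx V E Q σ τ bd → Poinc k V E σ τ → Coh Q bd → DualPoinc k E Q bd → KunnethGap k V E Q σ τ bd)
    (hA : open Literature.MathematicalPhysics.QuantumFieldTheory Literature.MathematicalPhysics.QuantumLattice MeasureTheory in ∀ (G : Type) [Group G] [TopologicalSpace G] [IsTopologicalGroup G] [CompactSpace G], IsCompactSimpleLieGroup G → letI : MeasurableSpace G := borel G; haveI : BorelSpace G := ⟨rfl⟩; ∀ r : LatticeRep G, let Fam := fun (k j : ℕ) (V E Q : Finset ℕ) (σ τ : ℕ → ℕ) (bd : ℕ → Fin 4 → ℕ × Bool) (cV : ℕ → ℤ × ℤ → ℕ) (cE : ℕ → ℤ × ℤ → Fin 2 → ℕ × Bool) => let st := fun e : ℕ × Bool => if e.2 then σ e.1 else τ e.1; let en := fun e : ℕ × Bool => if e.2 then τ e.1 else σ e.1; let Γ := SimpleGraph.fromRel fun a b : ℕ => ∃ e ∈ E, σ e = a ∧ τ e = b; let dg := fun x : ℕ => (E.filter fun e => σ e = x ∨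 τ e = x).card; let K := V.filter fun x => dg x = 5; let F := fun x : ℕ => x ∈ V ∧ ∀ c ∈ K, k / 2 < Γ.dist x c; let Dp := fun x : ℕ => x ∈ V ∧ ∀ c ∈ K, 3 * (k / 4) < Γ.dist x c; let ib := fun a : ℤ × ℤ => |a.1| ≤ (k : ℤ) / 4 ∧ |a.2| ≤ (k : ℤ) / 4; let nx := fun (a : ℤ × ℤ) (μ : Fin 2) => if μ = 0 then (a.1 + 1, a.2) else (a.1, a.2 + 1); let Ed := (ℕ × ℕ) ⊕ (ℕ × ℕ); let PE : Finset Ed := (E ×ˢ V).disjSum (V ×ˢ E); let Cfg := ↥PE → G; let ν := Measure.pi fun _ : ↥PE => haarProbability G; let v := fun (U : Cfg) (e : Ed × Bool) => if h : e.1 ∈ PE then (if e.2 then U ⟨e.1, h⟩ else (U ⟨e.1, h⟩)⁻¹) else 1; let w := fun (U : Cfg) (e : Fin 4 → Ed × Bool) => (r.ρ (v U (e 0) * v U (e 1) * v U (e 2) * v U (e 3))).trace.re; let S := fun U : Cfg => (∑ q ∈ Q, ∑ y ∈ V, w U fun i => (Sum.inl ((bd q i).1, y), (bd q i).2)) + (∑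 y ∈ V, ∑ q ∈ Q, w U fun i => (Sum.inr (y, (bd q i).1), (bd q i).2)) + ∑ e ∈ E, ∑ e' ∈ E, w U ![(Sum.inl (e, σ e'), true), (Sum.inr (τ e, e'), true), (Sum.inl (e, τ e'), false), (Sum.inr (σ e, e'), false)]; let d0 : Fin 4 → Fin 2 := ![0, 1, 0, 1]; let P := fun (x x' : ℕ) (U : Cfg) (p : ZdEdge 4) => let a := (p.1 0, p.1 1); let b := (p.1 2, p.1 3); if p.2 = 0 ∨ p.2 = 1 then v U (Sum.inl ((cE x a (d0 p.2)).1, cV x' b), (cE x a (d0 p.2)).2) else v U (Sum.inr (cV x a, (cE x' b (d0 p.2)).1), (cE x' b (d0 p.2)).2); ((∀ e ∈ E, σ e ∈ V ∧ τ e ∈ V ∧ σ e ≠ τ e) ∧ (∀ q ∈ Q, (∀ i, (bd q i).1 ∈ E) ∧ (∀ i, en (bd q i) = st (bd q (i + 1))) ∧ (st ∘ bd q).Injective) ∧ (∀ e ∈ E, (Q.filter fun q => ∃ i, (bd q i).1 = e).card = 2) ∧ (∀ x ∈ V, (dg x = 4 ∨ dg x = 5) ∧ (Q.filter fun q => ∃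 i, st (bd q i) = x).card = dg x) ∧ (∀ x ∈ V, ∃ c ∈ K, Γ.dist x c ≤ k) ∧ (∀ c ∈ K, ∀ c' ∈ K, c ≠ c' → k ≤ Γ.dist c c') ∧ (∀ f : ℕ → ℝ, ∑ x ∈ V, f x = 0 → ∑ x ∈ V, f x ^ 2 ≤ 10 ^ 6 * (k : ℝ) ^ 2 * ∑ e ∈ E, (f (σ e) - f (τ e)) ^ 2) ∧ (∃ x y, Dp x ∧ Dp y ∧ j ≤ Γ.dist x y) ∧ (∀ x, F x → cV x (0, 0) = x ∧ (∀ a, ib a → cV x a ∈ V) ∧ Set.InjOn (cV x) {a | ib a} ∧ (∀ a μ, ib a → ib (nx a μ) → (cE x a μ).1 ∈ E ∧ st (cE x a μ) = cV x a ∧ en (cE x a μ) = cV x (nx a μ)) ∧ (∀ a, ib a → ib (a.1 + 1, a.2 + 1) → ∃ q ∈ Q, Finset.univ.image (Prod.fst ∘ bd q) = {(cE x a 0).1, (cE x (nx a 0) 1).1, (cE x (nx a 1) 0).1, (cE x a 1).1})), fun (β m C : ℝ) (A B : YMSpecies G) => let X := fun f : Cfg → ℝ => (∫ U, f U * Real.exp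 (β * S U) ∂ν) / (∫ U, Real.exp (β * S U) ∂ν); ∀ x x' y y', F x → F x' → F y → F y' → |X (fun U => A.F (P x x' U) * B.F (P y y' U)) - X (fun U => A.F (P x x' U)) * X (fun U => B.F (P y y' U))| ≤ C * Real.exp (-(m * ((Γ.dist x y + Γ.dist x' y' : ℕ) : ℝ)))); let Sp := fun (A : YMSpecies G) (R : ℕ) => ∀ p ∈ A.supp, ∀ i, |p.1 i| ≤ (R : ℤ); ∀ (CT : ℕ) (V E Q : ℕ → ℕ → Finset ℕ) (σ τ : ℕ → ℕ → ℕ → ℕ) (bd : ℕ → ℕ → ℕ → Fin 4 → ℕ × Bool) (cV : ℕ → ℕ → ℕ → ℤ × ℤ → ℕ) (cE : ℕ → ℕ → ℕ → ℤ × ℤ → Fin 2 → ℕ × Bool), let Φ := fun k j => Fam k j (V k j) (E k j) (Q k j) (σ k j) (τ k j) (bd k j) (cV k j) (cE k j); (∀ k j, 8 ≤ k → (Φ k j).1) → (∀ k j, 8 ≤ k → ∃ L : ℕ, j ≤ L ∧ Tame L (V k j) (E k j) (Q k j) (σ k j) (τ k j) (bd k j) ∧ ∀ x ∈ V k j, ∀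 y ∈ V k j, (SimpleGraph.fromRel fun a b : ℕ => ∃ e ∈ E k j, σ k j e = a ∧ τ k j e = b).dist x y ≤ CT * L) → (∀ k j, 8 ≤ k → KunnethGap k (V k j) (E k j) (Q k j) (σ k j) (τ k j) (bd k j)) → ∃ c : ℝ, 0 < c ∧ ∀ k, 8 ≤ k → ∃ β₀ : ℝ, ∀ β, β₀ ≤ β → ∀ A B : YMSpecies G, Sp A (k / 8) → Sp B (k / 8) → ∃ C j₀, ∀ j, j₀ ≤ j → (Φ k j).2 β (c / k) C A B) :
    Summit.QuantumFields.YangMills.Theses.HyperbolicRegulator.CurvatureAnchorR := by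
  intro G _ _ _ _ hG r
  obtain ⟨CT, V, E, Q, σ, τ, bd, cV, cE, h⟩ := hT
  refine ⟨V, E, Q, σ, τ, bd, cV, cE, fun k j hk => (h k j hk).1, ?_⟩
  exact hA G hG r CT V E Q σ τ bd cV cE (fun k j hk => (h k j hk).1)
    (fun k j hk => (h k j hk).2.1)
    (fun k j hk => by
      obtain ⟨⟨h1, h2, h3, -, -, -, h7, -⟩, -, hC, hD⟩ := h k j hk
      exact hK k (V k j) (E k j) (Q k j) (σ k j) (τ k j) (bd k j) ⟨h1, h2, h3⟩ h7 hC hD)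

/-- Signature match: the registered composition has literally the route's crux as its type. -/
example : Summit.QuantumFields.YangMills.Theses.HyperbolicRegulator.CurvatureAnchorR := CurvatureAnchorR_of

end Summit.QuantumFields.YangMills.Cruxes.CurvatureAnchorR.GiantBetaGJS

end
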